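import Summits.CriticalPhenomena.PercolationContinuityZ3.Theorems.PercNearOneGluingNoHeavyLowerTailMajorityGluingTypeTableScaledSound
import HarnessLib

/-!
# Template S in the kernel: the closing arguments (pure real analysis) and the rational closing checks
(lane prim-rate, constants-miner 1, gen 30; RIGOROUS-CERTIFICATION.md §4 «Bounds»; KERNEL-WINDOW.md §0 (5)(i))

Support file for the closed crux `NoHeavyLowerTail` (stmt-CriticalPhenomena-4575), majority-gluing line; continuation of
`…TypeTableScaledSound`.  THE CLOSING STEP of THEOREM BOTTOM-3 in the kernel, for a law at hub weight `0 < M ≤ M_top` with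
scale factor `Λ = (M_top/M)^{s}` (`s ≥ 1`):

* `closeA_real` — `3E ≤ U₄`, `U₄^{c₄} ≤ M^{4−c₄}·Π`, `Λ⁴Π ≤ W⁴`, `W⁴ ≤ 3^{c₄}M_top^{2c₄−4}` ⟹ `E ≤ M` (world A);
* `closeB_real` — the same with `Π = (S_w+T_w)·Π₃`, `S_w+T_w ≤ (2+h)T_w`, `T_w ≤ 1`, `Λ³Π₃ ≤ W³`, `(2+h)W³ ≤ 3^{c₄}M_top^{2c₄−4}`;
* `close8_real` — `8E ≤ u₁₂₃ + u₁₂₄`, `u_S^{c₃} ≤ M^{3−c₃}Π_S`, `Λ³Π_S ≤ W_S³`, `W_S^{3/c₃} ≤ Y_S`, `Y₁+Y₂ ≤ 8M_top^{2−3/c₃}`;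
* `closeA_W4`, `closeB_W3`, `close8_Y` — the rational checks `closeA / closeB / close8` of `…TypeTableScaledDefs` imply the
  respective real hypotheses (`RAU ≥ M_top^{κ₀−1}`, `R8U ≥ M_top^{3q₃−2}` by the grid brackets, `c_w ≤ CWU` by `rpow_le_cert`).

No percolation, no sorries.  [cite: VandenbergHaggstromKahn2005, Thm. 1.3 (p. 6)]
-/

namespace Summit.CriticalPhenomena.PercolationContinuityZ3.Theorems

namespace HubOnly
namespace TypeTable

open DType

noncomputable section

/-! ### The three closing arguments -/

/-- The scale comparison: `M_t^{e} ≤ M^{e}·((M_t/M)^s)^n` for `0 < M ≤ M_t`, `0 ≤ e ≤ n·s`. -/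
theorem scale_compare {M Mt s e : ℝ} {n : ℕ} (hM : 0 < M) (hMt : M ≤ Mt) (he : e ≤ n * s) :
    Mt ^ e ≤ M ^ e * ((Mt / M) ^ s) ^ n := by
  have hl1 : 1 ≤ Mt / M := by rw [le_div_iff₀ hM, one_mul]; exact hMt
  have hl0 : 0 ≤ Mt / M := le_trans zero_le_one hl1
  have e1 : Mt ^ e = M ^ e * (Mt / M) ^ e := by
    rw [← Real.mul_rpow hM.le hl0, mul_div_cancel₀ _ (ne_of_gt hM)]
  rw [e1, ← Real.rpow_natCast, ← Real.rpow_mul hl0]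
  refine mul_le_mul_of_nonneg_left ?_ (Real.rpow_nonneg hM.le _)
  exact Real.rpow_le_rpow_of_exponent_le hl1 (by rw [mul_comm]; exact he)

/-- **World A closing.** -/
theorem closeA_real {E U P M Mt s c W4 : ℝ} (hM : 0 < M) (hMt : M ≤ Mt) (hs : 1 ≤ s) (hc2 : 2 < c) (hc3 : c ≤ 3)
    (h3E : 3 * E ≤ U) (hiso : U ^ c ≤ M ^ (4 - c) * P)
    (hprod : ((Mt / M) ^ s) ^ 4 * P ≤ W4) (hclose : W4 ≤ 3 ^ c * Mt ^ (2 * c - 4)) : E ≤ M := by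
  by_cases hE : E ≤ 0
  · linarith
  push Not at hE
  have hU : 0 ≤ U := by linarith
  have hc0 : 0 < c := by linarith
  have hl1 : 1 ≤ Mt / M := by rw [le_div_iff₀ hM, one_mul]; exact hMt
  set L := (Mt / M) ^ s with hL
  have hL1 : 1 ≤ L := Real.one_le_rpow hl1 (by linarith)
  have hL0 : 0 < L := by linarith
  have hL4 : 0 < L ^ 4 := by positivity
  have hP' : P ≤ W4 / L ^ 4 := by rw [le_div_iff₀ hL4]; linarith [hprod]
  have hMb : 0 ≤ M ^ (4 - c) := Real.rpow_nonneg hM.le _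
  -- U^c ≤ M^{4-c} 3^c Mt^{2c-4} / L^4 ≤ (3M)^c
  have h1 : U ^ c ≤ M ^ (4 - c) * (3 ^ c * Mt ^ (2 * c - 4)) / L ^ 4 := by
    calc U ^ c ≤ M ^ (4 - c) * P := hiso
      _ ≤ M ^ (4 - c) * (W4 / L ^ 4) := mul_le_mul_of_nonneg_left hP' hMb
      _ ≤ M ^ (4 - c) * (3 ^ c * Mt ^ (2 * c - 4) / L ^ 4) :=
          mul_le_mul_of_nonneg_left (div_le_div_of_nonneg_right hclose hL4.le) hMb
      _ = _ := by ring
  have hsc := scale_compare (n := 4) hM hMt (by push_cast; linarith : 2 * c - 4 ≤ ((4 : ℕ) : ℝ) * s)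
  rw [← hL] at hsc
  have h2 : M ^ (4 - c) * (3 ^ c * Mt ^ (2 * c - 4)) / L ^ 4 ≤ (3 * M) ^ c := by
    rw [div_le_iff₀ hL4, Real.mul_rpow (by norm_num) hM.le]
    have e : (3 : ℝ) ^ c * M ^ c * L ^ 4 = 3 ^ c * (M ^ (4 - c) * (M ^ (2 * c - 4) * L ^ 4)) := by
      rw [← mul_assoc (M ^ (4 - c)), ← Real.rpow_add hM]; ring_nf
    rw [e]
    have h3c : 0 ≤ (3 : ℝ) ^ c := Real.rpow_nonneg (by norm_num) _
    calc M ^ (4 - c) * (3 ^ c * Mt ^ (2 * c - 4)) = 3 ^ c * (M ^ (4 - c) * Mt ^ (2 * c - 4)) := by ring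
      _ ≤ 3 ^ c * (M ^ (4 - c) * (M ^ (2 * c - 4) * L ^ 4)) :=
          mul_le_mul_of_nonneg_left (mul_le_mul_of_nonneg_left hsc hMb) h3c
  have h3 : (3 * E) ^ c ≤ (3 * M) ^ c :=
    (Real.rpow_le_rpow (by linarith) h3E hc0.le).trans (h1.trans h2)
  have := (Real.rpow_le_rpow_iff (by linarith) (by linarith) hc0).mp h3
  linarith

/-- **World B closing.** -/
theorem closeB_real {E U P3 M Mt s c W3 STw Tw h : ℝ} (hM : 0 < M) (hMt : M ≤ Mt) (hs : 1 ≤ s) (hc2 : 2 < c) (hc3 : c ≤ 3)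
    (hP3 : 0 ≤ P3) (hTw1 : Tw ≤ 1) (hh : 0 ≤ 2 + h) (hSTw : STw ≤ (2 + h) * Tw)
    (h3E : 3 * E ≤ U) (hiso : U ^ c ≤ M ^ (4 - c) * STw * P3)
    (hprod : ((Mt / M) ^ s) ^ 3 * P3 ≤ W3) (hclose : (2 + h) * W3 ≤ 3 ^ c * Mt ^ (2 * c - 4)) : E ≤ M := by
  by_cases hE : E ≤ 0
  · linarith
  push Not at hE
  have hU : 0 ≤ U := by linarith
  have hc0 : 0 < c := by linarith
  have hl1 : 1 ≤ Mt / M := by rw [le_div_iff₀ hM, one_mul]; exact hMt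
  set L := (Mt / M) ^ s with hL
  have hL1 : 1 ≤ L := Real.one_le_rpow hl1 (by linarith)
  have hL0 : 0 < L := by linarith
  have hL3 : 0 < L ^ 3 := by positivity
  have hP' : P3 ≤ W3 / L ^ 3 := by rw [le_div_iff₀ hL3]; linarith [hprod]
  have hMb : 0 ≤ M ^ (4 - c) := Real.rpow_nonneg hM.le _
  have hST : STw ≤ 2 + h := hSTw.trans (by nlinarith)
  have h1 : U ^ c ≤ M ^ (4 - c) * (3 ^ c * Mt ^ (2 * c - 4)) / L ^ 3 := by
    calc U ^ c ≤ M ^ (4 - c) * STw * P3 := hiso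
      _ ≤ M ^ (4 - c) * (2 + h) * (W3 / L ^ 3) := mul_le_mul (mul_le_mul_of_nonneg_left hST hMb) hP' hP3 (by positivity)
      _ = M ^ (4 - c) * ((2 + h) * W3) / L ^ 3 := by ring
      _ ≤ M ^ (4 - c) * (3 ^ c * Mt ^ (2 * c - 4)) / L ^ 3 :=
          div_le_div_of_nonneg_right (mul_le_mul_of_nonneg_left hclose hMb) hL3.le
  have hsc := scale_compare (n := 3) hM hMt (by push_cast; linarith : 2 * c - 4 ≤ ((3 : ℕ) : ℝ) * s)
  rw [← hL] at hsc
  have h2 : M ^ (4 - c) * (3 ^ c * Mt ^ (2 * c - 4)) / L ^ 3 ≤ (3 * M) ^ c := by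
    rw [div_le_iff₀ hL3, Real.mul_rpow (by norm_num) hM.le]
    have e : (3 : ℝ) ^ c * M ^ c * L ^ 3 = 3 ^ c * (M ^ (4 - c) * (M ^ (2 * c - 4) * L ^ 3)) := by
      rw [← mul_assoc (M ^ (4 - c)), ← Real.rpow_add hM]; ring_nf
    rw [e]
    have h3c : 0 ≤ (3 : ℝ) ^ c := Real.rpow_nonneg (by norm_num) _
    calc M ^ (4 - c) * (3 ^ c * Mt ^ (2 * c - 4)) = 3 ^ c * (M ^ (4 - c) * Mt ^ (2 * c - 4)) := by ring
      _ ≤ 3 ^ c * (M ^ (4 - c) * (M ^ (2 * c - 4) * L ^ 3)) :=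
          mul_le_mul_of_nonneg_left (mul_le_mul_of_nonneg_left hsc hMb) h3c
  have h3 : (3 * E) ^ c ≤ (3 * M) ^ c :=
    (Real.rpow_le_rpow (by linarith) h3E hc0.le).trans (h1.trans h2)
  have := (Real.rpow_le_rpow_iff (by linarith) (by linarith) hc0).mp h3
  linarith

/-- One relay triple in the all-top closing: `u ≤ M^{3q−1}·L^{-3q}·Y` from `u^{c} ≤ M^{3−c}P`, `L³P ≤ W³`, `W^{3q} ≤ Y` (`q = 1/c`). -/
theorem top_triple {u P M L W Y c : ℝ} (hM : 0 < M) (hL : 0 < L) (hc : 1 < c) (hu : 0 ≤ u) (hW : 0 ≤ W)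
    (hiso : u ^ c ≤ M ^ (3 - c) * P) (hprod : L ^ 3 * P ≤ W ^ 3) (hY : W ^ (3 * c⁻¹) ≤ Y) :
    u ≤ M ^ (3 * c⁻¹ - 1) * (L ^ (3 * c⁻¹))⁻¹ * Y := by
  have hc0 : 0 < c := by linarith
  have hq0 : 0 ≤ c⁻¹ := inv_nonneg.mpr hc0.le
  have hL3 : 0 < L ^ 3 := by positivity
  have hP' : P ≤ W ^ 3 / L ^ 3 := by rw [le_div_iff₀ hL3]; linarith [hprod]
  have hMb : 0 ≤ M ^ (3 - c) := Real.rpow_nonneg hM.le _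
  have h1 : u ^ c ≤ M ^ (3 - c) * (W ^ 3 / L ^ 3) := hiso.trans (mul_le_mul_of_nonneg_left hP' hMb)
  have h2 := RpowCert.le_rpow_inv hu hc0 h1
  refine h2.trans ?_
  have hW3 : 0 ≤ W ^ 3 / L ^ 3 := by positivity
  rw [Real.mul_rpow hMb hW3, Real.div_rpow (pow_nonneg hW _) hL3.le, ← Real.rpow_natCast W, ← Real.rpow_natCast L,
    ← Real.rpow_mul hW, ← Real.rpow_mul hL.le, ← Real.rpow_mul hM.le]
  push_cast
  have e1 : (3 - c) * c⁻¹ = 3 * c⁻¹ - 1 := by rw [sub_mul, mul_inv_cancel₀ (ne_of_gt hc0)]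
  rw [e1, div_eq_mul_inv]
  have hA : 0 ≤ M ^ (3 * c⁻¹ - 1) := Real.rpow_nonneg hM.le _
  have hB : 0 ≤ (L ^ (3 * c⁻¹))⁻¹ := inv_nonneg.mpr (Real.rpow_nonneg hL.le _)
  calc M ^ (3 * c⁻¹ - 1) * (W ^ (3 * c⁻¹) * (L ^ (3 * c⁻¹))⁻¹)
      = M ^ (3 * c⁻¹ - 1) * (L ^ (3 * c⁻¹))⁻¹ * W ^ (3 * c⁻¹) := by ring
    _ ≤ M ^ (3 * c⁻¹ - 1) * (L ^ (3 * c⁻¹))⁻¹ * Y := mul_le_mul_of_nonneg_left hY (mul_nonneg hA hB)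

/-- **All-top closing.** -/
theorem close8_real {E u1 u2 P1 P2 M Mt s c W1 W2 Y1 Y2 : ℝ} (hM : 0 < M) (hMt : M ≤ Mt) (hs : 1 ≤ s) (hc1 : 1 < c)
    (hq : (19 : ℝ) / 45 ≤ c⁻¹)
    (hu1 : 0 ≤ u1) (hu2 : 0 ≤ u2) (hW1 : 0 ≤ W1) (hW2 : 0 ≤ W2)
    (h8E : 8 * E ≤ u1 + u2) (hiso1 : u1 ^ c ≤ M ^ (3 - c) * P1) (hiso2 : u2 ^ c ≤ M ^ (3 - c) * P2)
    (hprod1 : ((Mt / M) ^ s) ^ 3 * P1 ≤ W1 ^ 3) (hprod2 : ((Mt / M) ^ s) ^ 3 * P2 ≤ W2 ^ 3)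
    (hY1 : W1 ^ (3 * c⁻¹) ≤ Y1) (hY2 : W2 ^ (3 * c⁻¹) ≤ Y2) (hclose : Y1 + Y2 ≤ 8 * Mt ^ (2 - 3 * c⁻¹)) : E ≤ M := by
  have hl1 : 1 ≤ Mt / M := by rw [le_div_iff₀ hM, one_mul]; exact hMt
  set L := (Mt / M) ^ s with hL
  have hL1 : 1 ≤ L := Real.one_le_rpow hl1 (by linarith)
  have hL0 : 0 < L := by linarith
  have t1 := top_triple hM hL0 hc1 hu1 hW1 hiso1 hprod1 hY1
  have t2 := top_triple hM hL0 hc1 hu2 hW2 hiso2 hprod2 hY2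
  set q := c⁻¹ with hqdef
  have hA : 0 ≤ M ^ (3 * q - 1) := Real.rpow_nonneg hM.le _
  have hLq : 0 < L ^ (3 * q) := Real.rpow_pos_of_pos hL0 _
  have hB : 0 ≤ (L ^ (3 * q))⁻¹ := inv_nonneg.mpr hLq.le
  have h1 : 8 * E ≤ M ^ (3 * q - 1) * (L ^ (3 * q))⁻¹ * (8 * Mt ^ (2 - 3 * q)) := by
    have := mul_le_mul_of_nonneg_left hclose (mul_nonneg hA hB)
    linarith [t1, t2]
  -- M^{3q-1} L^{-3q} Mt^{2-3q} ≤ M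
  have hsc : Mt ^ (2 - 3 * q) ≤ M ^ (2 - 3 * q) * L ^ (3 * q) := by
    have hl0 : 0 ≤ Mt / M := le_trans zero_le_one hl1
    have e1 : Mt ^ (2 - 3 * q) = M ^ (2 - 3 * q) * (Mt / M) ^ (2 - 3 * q) := by
      rw [← Real.mul_rpow hM.le hl0, mul_div_cancel₀ _ (ne_of_gt hM)]
    rw [e1, hL, ← Real.rpow_mul hl0]
    refine mul_le_mul_of_nonneg_left ?_ (Real.rpow_nonneg hM.le _)
    exact Real.rpow_le_rpow_of_exponent_le hl1 (by nlinarith)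
  have h2 : M ^ (3 * q - 1) * (L ^ (3 * q))⁻¹ * (8 * Mt ^ (2 - 3 * q)) ≤ 8 * M := by
    have := mul_le_mul_of_nonneg_left hsc hA
    rw [← mul_assoc, ← Real.rpow_add hM, show 3 * q - 1 + (2 - 3 * q) = 1 by ring, Real.rpow_one] at this
    calc M ^ (3 * q - 1) * (L ^ (3 * q))⁻¹ * (8 * Mt ^ (2 - 3 * q))
        = 8 * (L ^ (3 * q))⁻¹ * (M ^ (3 * q - 1) * Mt ^ (2 - 3 * q)) := by ring
      _ ≤ 8 * (L ^ (3 * q))⁻¹ * (M * L ^ (3 * q)) := mul_le_mul_of_nonneg_left this (by positivity)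
      _ = 8 * M := by field_simp
  linarith

/-! ### From the rational checks to the real closing hypotheses -/

/-- `RAU K ≥ M_top^{κ₀−1} = M_top^{2−4p}⁻¹`… precisely `M_top^{-(2 − 4/c₄)} ≤ RAU K`, and `R8U K ≥ M_top^{3/c₃ − 2}`. -/
theorem RAU_R8U_ge (K : ℕ) :
    Mtop K ^ (-(2 - 4 * ((3 + Real.sqrt (11 / 3)) / 2)⁻¹)) ≤ ((RAU K : ℚ) : ℝ) ∧
    Mtop K ^ (-(2 - 3 * ((3 + Real.sqrt 3) / 2)⁻¹)) ≤ ((R8U K : ℚ) : ℝ) := by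
  have h2 : (0 : ℝ) ≤ 2 := by norm_num
  have g1 := grid_le ETAL_pos eta_bounds.1 eta_bounds.2 (2 * (K : ℤ))
  have g4 := grid_le (by decide +kernel) theta4_bounds.1 theta4_bounds.2 (-(4 * (K : ℤ)))
  have g3 := grid_le (by decide +kernel) theta3_bounds.1 theta3_bounds.2 (-(3 * (K : ℤ)))
  constructor
  · have e : Mtop K ^ (-(2 - 4 * ((3 + Real.sqrt (11 / 3)) / 2)⁻¹)) =
        (2 : ℝ) ^ ((1 : ℝ) / 32 * (((2 * (K : ℤ) : ℤ)) : ℝ)) * (2 : ℝ) ^ (((3 + Real.sqrt (11 / 3)) / 2)⁻¹ / 32 * ((-(4 * (K : ℤ)) : ℤ) : ℝ)) := by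
      simp only [Mtop]; rw [← Real.rpow_mul h2, ← Real.rpow_add (by norm_num)]; congr 1; push_cast; ring
    have hp := mul_le_mul g1 g4 (by positivity) (le_trans (by positivity) g1)
    refine le_trans (le_of_eq ?_) (hp.trans (le_of_eq ?_))
    · rw [e]
    · simp only [RAU]; push_cast; ring
  · have e : Mtop K ^ (-(2 - 3 * ((3 + Real.sqrt 3) / 2)⁻¹)) =
        (2 : ℝ) ^ ((1 : ℝ) / 32 * (((2 * (K : ℤ) : ℤ)) : ℝ)) * (2 : ℝ) ^ (((3 + Real.sqrt 3) / 2)⁻¹ / 32 * ((-(3 * (K : ℤ)) : ℤ) : ℝ)) := by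
      simp only [Mtop]; rw [← Real.rpow_mul h2, ← Real.rpow_add (by norm_num)]; congr 1; push_cast; ring
    have hp := mul_le_mul g1 g3 (by positivity) (le_trans (by positivity) g1)
    refine le_trans (le_of_eq ?_) (hp.trans (le_of_eq ?_))
    · rw [e]
    · simp only [R8U]; push_cast; ring

/-- `W^{α} ≤ R` from `W ≤ 1`, `a/b ≤ α`, and `W^a ≤ R^b` for rationals `W ≥ 0`, `R ≥ 0` (`b > 0`). -/
theorem ratpow_le {W R : ℚ} {α : ℝ} {a b : ℕ} (hW0 : 0 ≤ W) (hW1 : W ≤ 1) (hb : b ≠ 0) (hR : 0 ≤ R) (hα : (a : ℝ) / b ≤ α)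
    (hab : W ^ a ≤ R ^ b) : (W : ℝ) ^ α ≤ (R : ℝ) := by
  have hW0' : (0 : ℝ) ≤ W := by exact_mod_cast hW0
  have hW1' : (W : ℝ) ≤ 1 := by exact_mod_cast hW1
  have h1 : (W : ℝ) ^ α ≤ (W : ℝ) ^ ((a : ℝ) / b) := Real.rpow_le_rpow_of_exponent_ge' hW0' hW1' (by positivity) hα
  refine h1.trans ?_
  have hR' : (0 : ℝ) ≤ R := by exact_mod_cast hR
  refine le_of_pow_le_pow_left₀ hb hR' ?_
  rw [← Real.rpow_natCast, ← Real.rpow_mul hW0', div_mul_cancel₀ _ (by exact_mod_cast hb), Real.rpow_natCast]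
  exact_mod_cast hab

/-- **`closeA` ⟹ the world-A closing hypothesis**: `(V/N_obj)^4 ≤ 3^{c₄}·M_top^{2c₄−4}`. -/
theorem closeA_W4 {K : ℕ} {V : ℚ} (hV : 0 ≤ V) (h : closeA K V = true) :
    (((V / NOBJ : ℚ)) : ℝ) ^ 4 ≤ (3 : ℝ) ^ ((3 + Real.sqrt (11 / 3)) / 2) * Mtop K ^ (2 * ((3 + Real.sqrt (11 / 3)) / 2) - 4) := by
  set c := (3 + Real.sqrt (11 / 3)) / 2 with hc
  obtain ⟨hcpos, hql, hqu, hq2, hn⟩ := c4_facts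
  rw [← hc] at hcpos hql hqu hq2 hn
  simp only [closeA, Bool.and_eq_true, decide_eq_true_eq] at h
  obtain ⟨hW1, hcl⟩ := h
  set W : ℚ := V / NOBJ with hWdef
  have hW0 : 0 ≤ W := div_nonneg hV (by norm_num [NOBJ])
  have hRA : 0 < RAU K := mul_pos (powUp_pos (by decide +kernel) (by decide +kernel) _) (powUp_pos (by decide +kernel) (by decide +kernel) _)
  -- W^{13} ≤ (3/RAU)^8, hence W^{4/c} ≤ W^{13/8} ≤ 3/RAU ≤ 3 Mtop^{2 - 4/c}
  have hab : W ^ 13 ≤ (3 / RAU K) ^ 8 := by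
    have e : (RAU K / 3) ^ 8 * W ^ 13 = W ^ 13 / (3 / RAU K) ^ 8 := by field_simp
    rw [e, div_le_iff₀ (by positivity)] at hcl; linarith
  have hqle : ((13 : ℕ) : ℝ) / (8 : ℕ) ≤ 4 * c⁻¹ := by
    have e1 : ((QL4 : ℚ) : ℝ) = 406929669182 / 10 ^ 12 := by norm_num [QL4]
    rw [e1] at hql; push_cast; linarith
  have h1 := ratpow_le hW0 hW1 (by norm_num) (by positivity) hqle hab
  have hRA' := (RAU_R8U_ge K).1
  rw [← hc] at hRA'
  have hMt : 0 < Mtop K := Mtop_pos K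
  have h2 : (((3 / RAU K : ℚ)) : ℝ) ≤ 3 * Mtop K ^ (2 - 4 * c⁻¹) := by
    push_cast
    rw [div_le_iff₀ (by exact_mod_cast hRA)]
    have e : 3 * Mtop K ^ (2 - 4 * c⁻¹) * (RAU K : ℝ) = 3 * (Mtop K ^ (2 - 4 * c⁻¹) * (RAU K : ℝ)) := by ring
    rw [e]
    have : 1 ≤ Mtop K ^ (2 - 4 * c⁻¹) * (RAU K : ℝ) := by
      have hm := mul_le_mul_of_nonneg_left hRA' (Real.rpow_nonneg hMt.le (2 - 4 * c⁻¹))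
      rw [← Real.rpow_add hMt, show (2 - 4 * c⁻¹) + -(2 - 4 * c⁻¹) = 0 by ring, Real.rpow_zero] at hm
      exact hm
    linarith
  -- raise to the power c
  have hWc : ((W : ℚ) : ℝ) ^ (4 * c⁻¹) ≤ 3 * Mtop K ^ (2 - 4 * c⁻¹) := h1.trans h2
  have hW0' : (0 : ℝ) ≤ W := by exact_mod_cast hW0
  have h3 := Real.rpow_le_rpow (Real.rpow_nonneg hW0' _) hWc hcpos.le
  rw [← Real.rpow_mul hW0', show 4 * c⁻¹ * c = (4 : ℕ) by push_cast; field_simp, Real.rpow_natCast,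
    Real.mul_rpow (by norm_num) (Real.rpow_nonneg hMt.le _), ← Real.rpow_mul hMt.le] at h3
  have e2 : (2 - 4 * c⁻¹) * c = 2 * c - 4 := by field_simp
  rw [e2] at h3
  simpa [hWdef] using h3

/-- `c_w = (2+h)^{1/c₄} ≤ CWU h` for the table's entries. -/
theorem cw_le_CWU {h cw : ℚ} (hcw : CWU h = some cw) : (2 + (h : ℝ)) ^ ((3 + Real.sqrt (11 / 3)) / 2)⁻¹ ≤ ((cw : ℚ) : ℝ) := by
  obtain ⟨-, -, -, -, -, -, -, -, hp⟩ := cb_brackets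
  unfold CWU at hcw
  split_ifs at hcw with h1 h2 <;> simp only [Option.some.injEq] at hcw
  · subst h1; rw [← hcw]
    have e : (2 + (((1 / 2 : ℚ)) : ℝ)) = (((5 / 2 : ℚ)) : ℝ) := by push_cast; norm_num
    rw [e]
    refine le_trans ?_ (by norm_num : (((1451889635351 / 1000000000000 : ℚ)) : ℝ) ≤ _)
    exact RpowCert.rpow_le_cert (t := 5 / 2) (R := 1451889635351 / 1000000000000) (a := 1609) (b := 3954)
      (by norm_num) (by norm_num) (by norm_num) (Or.inr ⟨by norm_num, by push_cast; linarith⟩) (by decide +kernel)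
  · subst h2; rw [← hcw]
    have e : (2 + (((1 : ℚ)) : ℝ)) = (((3 : ℚ)) : ℝ) := by push_cast; norm_num
    rw [e]
    refine le_trans ?_ (by norm_num : (((195463116057 / 125000000000 : ℚ)) : ℝ) ≤ _)
    exact RpowCert.rpow_le_cert (t := 3) (R := 195463116057 / 125000000000) (a := 1609) (b := 3954)
      (by norm_num) (by norm_num) (by norm_num) (Or.inr ⟨by norm_num, by push_cast; linarith⟩) (by decide +kernel)

/-- **`closeB` ⟹ the world-B closing hypothesis**: `(2+h)·(V/N_obj)^3 ≤ 3^{c₄}·M_top^{2c₄−4}`. -/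
theorem closeB_W3 {K : ℕ} {h V : ℚ} (hV : 0 ≤ V) (hh : 0 ≤ 2 + h) (hb : closeB K h V = true) :
    (2 + (h : ℝ)) * (((V / NOBJ : ℚ)) : ℝ) ^ 3 ≤ (3 : ℝ) ^ ((3 + Real.sqrt (11 / 3)) / 2) * Mtop K ^ (2 * ((3 + Real.sqrt (11 / 3)) / 2) - 4) := by
  set c := (3 + Real.sqrt (11 / 3)) / 2 with hc
  obtain ⟨hcpos, hql, hqu, hq2, hn⟩ := c4_facts
  rw [← hc] at hcpos hql hqu hq2 hn
  unfold closeB at hb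
  cases hcw : CWU h with
  | none => simp [hcw] at hb
  | some cw =>
    simp only [hcw, Bool.and_eq_true, decide_eq_true_eq] at hb
    obtain ⟨hW1, hcl⟩ := hb
    set W : ℚ := V / NOBJ with hWdef
    have hW0 : 0 ≤ W := div_nonneg hV (by norm_num [NOBJ])
    have hcwpos : 0 < cw := by
      unfold CWU at hcw; split_ifs at hcw <;> simp only [Option.some.injEq] at hcw <;> rw [← hcw] <;> norm_num
    have hRA : 0 < RAU K := mul_pos (powUp_pos (by decide +kernel) (by decide +kernel) _) (powUp_pos (by decide +kernel) (by decide +kernel) _)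
    have hab : W ^ 6 ≤ (3 / (RAU K * cw)) ^ 5 := by
      have e : (RAU K * cw / 3) ^ 5 * W ^ 6 = W ^ 6 / (3 / (RAU K * cw)) ^ 5 := by field_simp
      rw [e, div_le_iff₀ (by positivity)] at hcl; linarith
    have hqle : ((6 : ℕ) : ℝ) / (5 : ℕ) ≤ 3 * c⁻¹ := by
      have e1 : ((QL4 : ℚ) : ℝ) = 406929669182 / 10 ^ 12 := by norm_num [QL4]
      rw [e1] at hql; push_cast; linarith
    have h1 := ratpow_le hW0 hW1 (by norm_num) (by positivity) hqle hab
    have hRA' := (RAU_R8U_ge K).1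
    rw [← hc] at hRA'
    have hMt : 0 < Mtop K := Mtop_pos K
    have hcwle := cw_le_CWU hcw
    rw [← hc] at hcwle
    have hhc : 0 ≤ (2 + (h : ℝ)) ^ c⁻¹ := Real.rpow_nonneg (by exact_mod_cast hh) _
    -- (2+h)^{1/c} W^{3/c} ≤ 3 Mtop^{2-4/c}
    have h2 : (2 + (h : ℝ)) ^ c⁻¹ * ((W : ℚ) : ℝ) ^ (3 * c⁻¹) ≤ 3 * Mtop K ^ (2 - 4 * c⁻¹) := by
      have step : (2 + (h : ℝ)) ^ c⁻¹ * ((W : ℚ) : ℝ) ^ (3 * c⁻¹) ≤ (cw : ℝ) * (((3 / (RAU K * cw) : ℚ)) : ℝ) :=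
        mul_le_mul hcwle h1 (Real.rpow_nonneg (by exact_mod_cast hW0) _) (by exact_mod_cast hcwpos.le)
      refine step.trans ?_
      push_cast
      have e : (cw : ℝ) * (3 / ((RAU K : ℝ) * cw)) = 3 / (RAU K : ℝ) := by field_simp
      rw [e, div_le_iff₀ (by exact_mod_cast hRA)]
      have : 1 ≤ Mtop K ^ (2 - 4 * c⁻¹) * (RAU K : ℝ) := by
        have hm := mul_le_mul_of_nonneg_left hRA' (Real.rpow_nonneg hMt.le (2 - 4 * c⁻¹))
        rw [← Real.rpow_add hMt, show (2 - 4 * c⁻¹) + -(2 - 4 * c⁻¹) = 0 by ring, Real.rpow_zero] at hm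
        exact hm
      nlinarith
    have hW0' : (0 : ℝ) ≤ W := by exact_mod_cast hW0
    have hL0 : 0 ≤ (2 + (h : ℝ)) ^ c⁻¹ * ((W : ℚ) : ℝ) ^ (3 * c⁻¹) := mul_nonneg hhc (Real.rpow_nonneg hW0' _)
    have h3 := Real.rpow_le_rpow hL0 h2 hcpos.le
    rw [Real.mul_rpow hhc (Real.rpow_nonneg hW0' _), ← Real.rpow_mul (by exact_mod_cast hh), ← Real.rpow_mul hW0',
      inv_mul_cancel₀ (ne_of_gt hcpos), Real.rpow_one, show 3 * c⁻¹ * c = (3 : ℕ) by push_cast; field_simp,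
      Real.rpow_natCast, Real.mul_rpow (by norm_num) (Real.rpow_nonneg hMt.le _), ← Real.rpow_mul hMt.le] at h3
    have e2 : (2 - 4 * c⁻¹) * c = 2 * c - 4 := by field_simp
    rw [e2] at h3
    simpa [hWdef] using h3

/-- **`close8` ⟹ the all-top closing hypotheses**: `W_S ≥ 0`, `W_S^{3/c₃} ≤ Y_S`, `Y₁ + Y₂ ≤ 8·M_top^{2 − 3/c₃}`. -/
theorem close8_Y {K : ℕ} {V1 V2 Y1 Y2 : ℚ} (hV1 : 0 ≤ V1) (hV2 : 0 ≤ V2) (h : close8 K V1 V2 Y1 Y2 = true) :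
    (0 : ℝ) ≤ ((V1 / NOBJ : ℚ) : ℝ) ∧ (0 : ℝ) ≤ ((V2 / NOBJ : ℚ) : ℝ) ∧
    (((V1 / NOBJ : ℚ)) : ℝ) ^ (3 * ((3 + Real.sqrt 3) / 2)⁻¹) ≤ ((Y1 : ℚ) : ℝ) ∧
    (((V2 / NOBJ : ℚ)) : ℝ) ^ (3 * ((3 + Real.sqrt 3) / 2)⁻¹) ≤ ((Y2 : ℚ) : ℝ) ∧
    ((Y1 : ℚ) : ℝ) + Y2 ≤ 8 * Mtop K ^ (2 - 3 * ((3 + Real.sqrt 3) / 2)⁻¹) := by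
  set c := (3 + Real.sqrt 3) / 2 with hc
  obtain ⟨hcpos, hql, hqu, hq2, hn⟩ := c3_facts
  rw [← hc] at hcpos hql hqu hq2 hn
  simp only [close8, Bool.and_eq_true, decide_eq_true_eq] at h
  obtain ⟨⟨⟨⟨⟨⟨hW1, hW2⟩, hY1⟩, hY2⟩, hp1⟩, hp2⟩, hcl⟩ := h
  have hW10 : 0 ≤ V1 / NOBJ := div_nonneg hV1 (by norm_num [NOBJ])
  have hW20 : 0 ≤ V2 / NOBJ := div_nonneg hV2 (by norm_num [NOBJ])
  have hqle : ((19 : ℕ) : ℝ) / (15 : ℕ) ≤ 3 * c⁻¹ := by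
    have e1 : ((QL3 : ℚ) : ℝ) = 422649730810 / 10 ^ 12 := by norm_num [QL3]
    rw [e1] at hql; push_cast; linarith
  have h1 := ratpow_le hW10 hW1 (by norm_num) hY1 hqle hp1
  have h2 := ratpow_le hW20 hW2 (by norm_num) hY2 hqle hp2
  have hR8 : 0 < R8U K := mul_pos (powUp_pos (by decide +kernel) (by decide +kernel) _) (powUp_pos (by decide +kernel) (by decide +kernel) _)
  have hR8' := (RAU_R8U_ge K).2
  rw [← hc] at hR8'
  have hMt : 0 < Mtop K := Mtop_pos K
  refine ⟨by exact_mod_cast hW10, by exact_mod_cast hW20, h1, h2, ?_⟩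
  have hsum : ((Y1 : ℚ) : ℝ) + Y2 ≤ 8 / (R8U K : ℝ) := by
    rw [le_div_iff₀ (by exact_mod_cast hR8)]
    have : (((R8U K * (Y1 + Y2) : ℚ)) : ℝ) ≤ ((8 : ℚ) : ℝ) := by exact_mod_cast hcl
    push_cast at this; linarith
  refine hsum.trans ?_
  rw [div_le_iff₀ (by exact_mod_cast hR8)]
  have : 1 ≤ Mtop K ^ (2 - 3 * c⁻¹) * (R8U K : ℝ) := by
    have hm := mul_le_mul_of_nonneg_left hR8' (Real.rpow_nonneg hMt.le (2 - 3 * c⁻¹))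
    rw [← Real.rpow_add hMt, show (2 - 3 * c⁻¹) + -(2 - 3 * c⁻¹) = 0 by ring, Real.rpow_zero] at hm
    exact hm
  nlinarith

end

end TypeTable
end HubOnly

end Summit.CriticalPhenomena.PercolationContinuityZ3.Theorems
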